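import Literature.Probability.Percolation.NearCriticalRSWStart
import Literature.Probability.Percolation.NearCriticalRSW
import HarnessLib

/-!
# Nolin's Russo–Seymour–Welsh theorem on `𝕋` at general `p`, proved

Topic `Literature/Probability/Percolation`; family `crit-perc`. Proof-only file (no new definition,
no new named fact) DISCHARGING the three named facts of `NearCriticalCorrelationLengthLower.lean`
recording P. Nolin, *Near-critical percolation in two dimensions*, Electron. J. Probab. 13 (2008),
§3.1, Theorem "Russo–Seymour–Welsh" [arXiv 0711.4948: Thm. 2] for site percolation on the
triangular lattice at an ARBITRARY parameter `p` and a SINGLE scale `n`: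

* `Nolin2008_RSW_holds : Nolin2008_RSW` — "if the `n × n` box is crossed with probability `≥ δ`
  under `P_p`, the `2n × n` parallelogram is crossed the long way with probability `≥ f₂(δ) > 0`";
* `Nolin2008_RSW_one_holds : Nolin2008_RSW_one` — the "moreover" clause `f_k(δ) → 1` as `δ → 1`;
* `Nolin2008_RSW_thm_holds : Nolin2008_RSW_thm` — the printed form (universal non-decreasing
  `f_k`, positive on `(0, 1)`, tending to `1` at `1`).

Nolin gives no proof ("see [Grimmett 1999, §11.7], [Kesten 1982, Thm. 6.1]"); the classical
single-scale arguments of Russo / Seymour–Welsh / Kesten use a reflection symmetry of the box that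
the parallelograms of `𝕋` lack (Kesten's Thm. 6.1 needs two inputs, a horizontal and a vertical
crossing of boxes of comparable widths), and the symmetry-based single-scale theorem of
Köhler-Schindler–Tassion (2020) uses the rotation by `π/2`. The proof given here is different and
rests on what the tree already proves:

1. **Duality** `P_p(LR(m, n)) + P_{1-p}(LR(n, m)) = 1` (`triLRCrossingProb_add_eq_one`, the Hex
   lemma): at `p ≤ 1/2` the rhombus is crossed with probability `≤ 1/2`, so the "moreover" clause
   only concerns `p > 1/2`, where — read for the closed sites, of density `1 - p < 1/2` — it is a
   POSITIVITY statement: if the sub-critical colour crosses `[0, n] × [0, kn]` the easy way with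
   probability `> η`, it crosses the rhombus `[0, n]²` with probability `≥ t(k, η) > 0`.
2. **Nolin's Lemma 39 at a small `ε₀`, unconditionally** (`Nolin2008_lemma39_at_holds_small`,
   `NearCriticalRSWStart.lean`): for `p < 1/2`, `P_p(LR(n, kn)) ≤ C₁ e^{-C₂ n / L_ε(p)}`; hence a
   crossing probability `> η` forces `n ≤ M · L_ε(p)` with `M = M(η, k)`.
3. **Two-scale RSW below `L_ε(p)`** (`TriHexagon.triLRCrossingProb_two_scale_flex`,
   `TriRSWRounds.lean`, Bollobás–Riordan Ch. 3 Lemma 4 / Cor. 5 iterated in lattice hexagons): all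
   rhombi of side `< L_ε(p)` are crossed with probability `> ε`, so `P_p(LR(3h, h)) ≥ (ε/2)^466`
   at a scale `h ≍ min(n, L_ε(p))`, and **RSW chaining** (`pow_mul_pow_le_triLRCrossingProb_of_le`)
   crosses `[0, k n] × [0, h] ⊆ [0, k n] × [0, n]` with `O(k M)` pieces.
4. Small parameters (`p ≤ 1/4`, compared with `P_{1/4}` by monotonicity) and small scales are
   elementary: `P_p(LR(n, m)) ≤ (m + 1) p` (`triLRCrossingProb_le_mul`) bounds `p` from below and
   `p^{m+1} ≤ P_p(LR(m, n))` (`pow_succ_le_triLRCrossingProb`) bounds the crossing from below;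
   `p ≥ 1/2` is the RSW theorem at `1/2` (`tri_rsw_half_holds`, Smirnov) and monotonicity in `p`.

The common core is `rsw_engine`: for `k₁, k₂ ≥ 1` and `η > 0` there is `t > 0` with
`P_p(LR(n, k₁ n)) > η ⟹ P_p(LR(k₂ n, n)) ≥ t` for all `p < 1/2`, `n ≥ 1`.

## References

* P. Nolin, Near-critical percolation in two dimensions, *Electron. J. Probab.* 13 (2008), §3.1,
  Thm. "Russo–Seymour–Welsh" (arXiv 0711.4948: Thm. 2); §7.4 Lemma 39 (arXiv: Lemma 37) [Nolin2008].
* G. Grimmett, *Percolation*, 2nd ed. (1999), §11.7, Lemma 11.73, (11.75)–(11.77) [GrimmettPercolation1999].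
* H. Kesten, *Percolation theory for mathematicians* (1982), Thm. 6.1 [Kesten1982].
* B. Bollobás, O. Riordan, *Percolation* (2006), Ch. 3 Lemma 4, Cor. 5; Ch. 5 Lemma 7 [BollobasRiordan2006].
* L. Köhler-Schindler, V. Tassion, Crossing probabilities for planar percolation, arXiv:2011.04618
  (2020), Thm. 1 (the rotation by `π/2` enters in Lemma 1, case 2, and Lemma 3).

Tree: `Nolin2008_lemma39_at_holds_small` (`NearCriticalRSWStart.lean`),
`TriHexagon.triLRCrossingProb_two_scale_flex` (`TriRSWRounds.lean`),
`pow_mul_pow_le_triLRCrossingProb_of_le`, `triLRCrossingProb_anti_width` (`TriRSWChaining.lean`),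
`triLRCrossingProb_mono_height` (`TriShiftedCrossings.lean`), `triLRCrossingProb_add_eq_one`,
`TriHexExclusive.triLRCrossingProb_mono` (`TriHexExclusive.lean`), `charLength`,
`lt_triLRCrossingProb_of_lt_charLength` (`KestenScaling.lean`), `one_le_charLength`,
`Nolin2008_subcritical_crossing_holds` (`NearCriticalRSW.lean`), `min_symm_eq_self`
(`KestenRelationRusso.lean`), `triLRCrossingProb_le_mul`, `pow_succ_le_triLRCrossingProb`
(`NearCriticalCorrelationLengthLower.lean`), `tri_rsw_half_holds` (`TriThetaHalf.lean`),
`triLRCrossingProb_le_one'` (`TriRSWTwoScale.lean`). Mathlib: `Real.log`, `Real.exp`, `Nat.ceil`,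
`sInf` on `ℝ` (`csInf_le`, `le_csInf`, `csInf_le_csInf`), `tendsto_order`, `Ioo_mem_nhdsLT`.
-/

noncomputable section

open MeasureTheory Set Filter Topology
open scoped unitInterval

namespace Literature.Probability.Percolation

open LatticeModels

/-! ### An elementary inequality -/

/-- If `η < C₁ e^{-C₂ n / L}` with `η, C₂, L > 0` then `n ≤ (log (C₁ / η) / C₂) · L`. [folklore] -/
theorem le_mul_of_lt_mul_exp {η C₁ C₂ n L : ℝ} (hη : 0 < η) (hC₂ : 0 < C₂) (hL : 0 < L)
    (h : η < C₁ * Real.exp (-(C₂ * n / L))) : n ≤ Real.log (C₁ / η) / C₂ * L := by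
  have hexp := Real.exp_pos (-(C₂ * n / L))
  have hC₁ : 0 < C₁ := by
    by_contra hle
    push Not at hle
    nlinarith
  have h1 : η / C₁ < Real.exp (-(C₂ * n / L)) := by
    rw [div_lt_iff₀ hC₁]; linarith
  have h2 : Real.log (η / C₁) < -(C₂ * n / L) := by
    rwa [Real.log_lt_iff_lt_exp (div_pos hη hC₁)]
  have h3 : Real.log (C₁ / η) = -Real.log (η / C₁) := by
    rw [← Real.log_inv, inv_div]
  have h4 : C₂ * n / L < Real.log (C₁ / η) := by rw [h3]; linarith
  have h5 : C₂ * n < Real.log (C₁ / η) * L := by rwa [div_lt_iff₀ hL] at h4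
  have h6 : n ≤ Real.log (C₁ / η) * L / C₂ := by
    rw [le_div_iff₀ hC₂]; linarith
  calc n ≤ Real.log (C₁ / η) * L / C₂ := h6
    _ = Real.log (C₁ / η) / C₂ * L := by ring

/-! ### The engine: sub-critical crossings of comparable boxes at one scale -/

/-- **Single-scale RSW for the sub-critical colour.** For `k₁, k₂ ≥ 1` and `η > 0` there is
`t > 0` such that for every `p < 1/2` and `n ≥ 1`: if `P_p(LR_𝕋(n, k₁ n)) > η` then
`P_p(LR_𝕋(k₂ n, n)) ≥ t`. (Nolin 2008, Thm. 2, for `p < 1/2`; proof: Lemma 39 at a small `ε`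
bounds `n ≤ M L_ε(p)`, the two-scale RSW bound below `L_ε(p)` and RSW chaining produce the long
crossing, small `p` and small `n` are elementary — see the module docstring.) [cite: Nolin2008, §3.1 Thm. "Russo–Seymour–Welsh" (arXiv: Thm. 2); §7.4 Lemma 39 (arXiv: Lemma 37)] [cite: BollobasRiordan2006, Ch. 3 Lemma 4, Cor. 5] -/
theorem rsw_engine {k₁ k₂ : ℕ} (hk₁ : 1 ≤ k₁) (hk₂ : 1 ≤ k₂) {η : ℝ} (hη : 0 < η) :
    ∃ t : ℝ, 0 < t ∧ ∀ p : unitInterval, (p : ℝ) < 1 / 2 → ∀ n : ℕ, 1 ≤ n →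
      η < triLRCrossingProb p n (k₁ * n) → t ≤ triLRCrossingProb p (k₂ * n) n := by
  obtain ⟨ε₀, hε₀, h39⟩ := Nolin2008_lemma39_at_holds_small
  -- the tolerance `ε = min ε₀ (1/8)` and Lemma 39 at `(ε, k₁)`
  obtain ⟨ε, hε, hε8, hεε₀⟩ : ∃ ε : ℝ, 0 < ε ∧ ε ≤ 1 / 8 ∧ ε ≤ ε₀ :=
    ⟨min ε₀ (1 / 8), lt_min hε₀ (by norm_num), min_le_right _ _, min_le_left _ _⟩
  have h39k := h39 ε hεε₀
  obtain ⟨C₁, hC₁, C₂, hC₂, hdec⟩ := h39k k₁ hk₁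
  have hsub := Nolin2008_subcritical_crossing_holds
  -- the comparison parameter `q₀ = 1/4` and its characteristic length `L₀`
  set q₀ : unitInterval := ⟨1 / 4, by norm_num, by norm_num⟩ with hq₀def
  have hq₀ : ((q₀ : unitInterval) : ℝ) = 1 / 4 := rfl
  obtain ⟨L₀, hL₀def⟩ : ∃ L₀ : ℕ, L₀ = charLength ε q₀ := ⟨_, rfl⟩
  have hL₀ : 1 ≤ L₀ := by
    rw [hL₀def]; exact one_le_charLength hsub hε (by rw [hq₀]; linarith) (by rw [hq₀]; norm_num)
  have hL₀pos : (0 : ℝ) < L₀ := by exact_mod_cast hL₀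
  -- constants
  obtain ⟨M, hMdef⟩ : ∃ M : ℝ, M = max 1 (Real.log (C₁ / η) / C₂) := ⟨_, rfl⟩
  have hM1 : 1 ≤ M := by rw [hMdef]; exact le_max_left _ _
  have hMlog : Real.log (C₁ / η) / C₂ ≤ M := by rw [hMdef]; exact le_max_right _ _
  have hM0 : 0 < M := by linarith
  obtain ⟨φ, hφdef⟩ : ∃ φ : ℝ, φ = (ε / 2) ^ 466 := ⟨_, rfl⟩
  have hφ : 0 < φ := by rw [hφdef]; positivity
  obtain ⟨J, hJdef⟩ : ∃ J : ℕ, J = ⌈2 * k₂ * M⌉₊ + 2 := ⟨_, rfl⟩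
  have hJ1 : 1 ≤ J := by omega
  obtain ⟨Nb, hNb0, hNb1, hNb2⟩ : ∃ Nb : ℕ, ⌈M * L₀⌉₊ ≤ Nb ∧ 25 ≤ Nb ∧ ⌈26 * M⌉₊ ≤ Nb :=
    ⟨max ⌈M * L₀⌉₊ (max 25 ⌈26 * M⌉₊), le_max_left _ _,
      (le_max_left _ _).trans (le_max_right _ _), (le_max_right _ _).trans (le_max_right _ _)⟩
  obtain ⟨tb, htbdef⟩ : ∃ tb : ℝ, tb = (η / (k₁ * Nb + 1)) ^ (k₂ * Nb + 1) := ⟨_, rfl⟩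
  have htb : 0 < tb := by rw [htbdef]; positivity
  obtain ⟨tc, htcdef⟩ : ∃ tc : ℝ, tc = φ ^ J * ε ^ (J - 1) := ⟨_, rfl⟩
  have htc : 0 < tc := by rw [htcdef]; positivity
  refine ⟨min tb tc, lt_min htb htc, fun p hp n hn hηP => ?_⟩
  have hp0 : 0 ≤ (p : ℝ) := unitInterval.nonneg p
  have hp1 : (p : ℝ) ≤ 1 := unitInterval.le_one p
  have hn0 : (0 : ℝ) ≤ n := by positivity
  have hk₁0 : (0 : ℝ) ≤ k₁ := by positivity
  -- `p > η / (k₁ n + 1)`: a crossing needs an open site on the left side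
  have hplow : η / (k₁ * n + 1) < p := by
    have h := triLRCrossingProb_le_mul p n (k₁ * n)
    push_cast at h
    rw [div_lt_iff₀ (by positivity)]
    calc η < triLRCrossingProb p n (k₁ * n) := hηP
      _ ≤ (k₁ * n + 1) * p := h
      _ = p * (k₁ * n + 1) := by ring
  -- bounded scales: the straight bottom row
  have hbrute : n ≤ Nb → min tb tc ≤ triLRCrossingProb p (k₂ * n) n := by
    intro hnN
    have hnN' : (n : ℝ) ≤ Nb := by exact_mod_cast hnN
    have hb0 : 0 ≤ η / (k₁ * Nb + 1) := by positivity
    have hb1 : η / (k₁ * Nb + 1) ≤ η / (k₁ * n + 1) := by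
      apply div_le_div_of_nonneg_left hη.le (by positivity)
      have := mul_le_mul_of_nonneg_left hnN' hk₁0
      linarith
    have hb2 : η / (k₁ * n + 1) ≤ 1 := by linarith
    calc min tb tc ≤ tb := min_le_left _ _
      _ = (η / (k₁ * Nb + 1)) ^ (k₂ * Nb + 1) := htbdef
      _ ≤ (η / (k₁ * Nb + 1)) ^ (k₂ * n + 1) := by
          apply pow_le_pow_of_le_one hb0 (hb1.trans hb2)
          have : k₂ * n ≤ k₂ * Nb := Nat.mul_le_mul_left _ hnN
          omega
      _ ≤ (η / (k₁ * n + 1)) ^ (k₂ * n + 1) := pow_le_pow_left₀ hb0 hb1 _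
      _ ≤ (p : ℝ) ^ (k₂ * n + 1) := pow_le_pow_left₀ (by positivity) hplow.le _
      _ ≤ triLRCrossingProb p (k₂ * n) n := pow_succ_le_triLRCrossingProb p (k₂ * n) n
  rcases le_or_gt (p : ℝ) (1 / 4) with hp4 | hp4
  · -- (A) `p ≤ 1/4`: compare with `P_{1/4}`, for which Lemma 39 bounds the scale
    apply hbrute
    have hpq : p ≤ q₀ := Subtype.coe_le_coe.1 (by rw [hq₀]; exact hp4)
    have h1 : η < triLRCrossingProb q₀ n (k₁ * n) :=
      hηP.trans_le (TriHexExclusive.triLRCrossingProb_mono hpq _ _)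
    have h2 := hdec q₀ (by rw [hq₀]; norm_num) (hL₀def ▸ hL₀) n
    rw [← hL₀def] at h2
    have h3 : (n : ℝ) ≤ Real.log (C₁ / η) / C₂ * L₀ :=
      le_mul_of_lt_mul_exp hη hC₂ hL₀pos (h1.trans_le h2)
    have h4 : (n : ℝ) ≤ M * L₀ := h3.trans (mul_le_mul_of_nonneg_right hMlog hL₀pos.le)
    have h5 : (n : ℝ) ≤ (⌈M * L₀⌉₊ : ℕ) := h4.trans (Nat.le_ceil _)
    have h6 : n ≤ ⌈M * L₀⌉₊ := by exact_mod_cast h5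
    exact h6.trans hNb0
  · -- (B) `1/4 < p < 1/2`: work below `L = L_ε(p)`
    obtain ⟨L, hLdef⟩ : ∃ L : ℕ, L = charLength ε p := ⟨_, rfl⟩
    have hL1 : 1 ≤ L := by rw [hLdef]; exact one_le_charLength hsub hε (by linarith) hp
    have hLpos : (0 : ℝ) < L := by exact_mod_cast hL1
    have hnML : (n : ℝ) ≤ M * L := by
      have h2 := hdec p hp (hLdef ▸ hL1) n
      rw [← hLdef] at h2
      exact (le_mul_of_lt_mul_exp hη hC₂ hLpos (hηP.trans_le h2)).trans
        (mul_le_mul_of_nonneg_right hMlog hLpos.le)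
    -- the working scale `m = min n (L - 1)`
    obtain ⟨m, hmn, hmL, hmspec⟩ : ∃ m : ℕ, m ≤ n ∧ m < L ∧ (m = n ∨ (m = L - 1 ∧ L ≤ n)) := by
      by_cases hnL : n < L
      · exact ⟨n, le_rfl, hnL, Or.inl rfl⟩
      · exact ⟨L - 1, by omega, by omega, Or.inr ⟨rfl, by omega⟩⟩
    rcases lt_or_ge m 26 with hm26 | hm26
    · -- bounded case: `n < 26`, or `L ≤ 26` and `n ≤ 26 M`
      apply hbrute
      rcases hmspec with hm1 | ⟨hm1, hLn⟩
      · omega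
      · have hL26 : (L : ℝ) ≤ 26 := by exact_mod_cast (show L ≤ 26 by omega)
        have h1 : (n : ℝ) ≤ 26 * M := by nlinarith
        have h2 : (n : ℝ) ≤ (⌈26 * M⌉₊ : ℕ) := h1.trans (Nat.le_ceil _)
        have h3 : n ≤ ⌈26 * M⌉₊ := by exact_mod_cast h2
        exact h3.trans hNb2
    · -- main case: the two scales `2j`, `4j + 2 ≤ m < L`
      obtain ⟨j, hjdef⟩ : ∃ j : ℕ, j = (m - 2) / 4 := ⟨_, rfl⟩
      have hj6 : 6 ≤ j := by omega
      have hhm : 4 * j + 2 ≤ m := by omega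
      have hmh : m ≤ 4 * j + 2 + 3 := by omega
      have hhn : 4 * j + 2 ≤ n := hhm.trans hmn
      have hminp : min p (σ p) = p := min_symm_eq_self hp.le
      have hsc1 : ε < triLRCrossingProb p (2 * j) (2 * j) := by
        have h := lt_triLRCrossingProb_of_lt_charLength (ε := ε) (p := p) (n := 2 * j) (by omega)
        rwa [hminp] at h
      have hsc2' : ε < triLRCrossingProb p (4 * j + 2) (4 * j + 2) := by
        have h := lt_triLRCrossingProb_of_lt_charLength (ε := ε) (p := p) (n := 4 * j + 2) (by omega)
        rwa [hminp] at h
      have hsc2 : ε < triLRCrossingProb p (3 * j + (j + 1) + 1) (3 * j + (j + 1) + 1) := by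
        rwa [show 3 * j + (j + 1) + 1 = 4 * j + 2 by ring]
      have hMP : (ε / 2) ^ 466 ≤ triLRCrossingProb p (12 * j + 6) (4 * j + 2) :=
        TriHexagon.triLRCrossingProb_two_scale_flex p hj6 (by omega) le_rfl hε.le hsc1.le hsc2.le
      have hhard : φ ≤ triLRCrossingProb p (2 * (4 * j + 2)) (4 * j + 2) := by
        rw [hφdef]
        exact hMP.trans (triLRCrossingProb_anti_width p (show 2 * (4 * j + 2) ≤ 12 * j + 6 by omega) _)
      have hsq : ε ≤ triLRCrossingProb p (4 * j + 2) (4 * j + 2) := hsc2'.le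
      -- width bookkeeping: `n ≤ 2 M (4j + 2)`, hence `k₂ n ≤ (J + 1) (4j + 2)`
      have hx0 : (0 : ℝ) ≤ (4 * j + 2 : ℕ) := by positivity
      have hn2Mh : (n : ℝ) ≤ 2 * M * (4 * j + 2 : ℕ) := by
        rcases hmspec with hm1 | ⟨hm1, hLn⟩
        · -- `n < L`: `m = n ≤ 4j + 5`, so `n ≤ 2 (4j + 2)`
          have h1 : (n : ℝ) ≤ 2 * (4 * j + 2 : ℕ) := by
            exact_mod_cast (show n ≤ 2 * (4 * j + 2) by omega)
          calc (n : ℝ) ≤ 2 * (4 * j + 2 : ℕ) := h1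
            _ = 2 * 1 * (4 * j + 2 : ℕ) := by ring
            _ ≤ 2 * M * (4 * j + 2 : ℕ) :=
                mul_le_mul_of_nonneg_right (mul_le_mul_of_nonneg_left hM1 (by norm_num)) hx0
        · -- `n ≥ L`: `m = L - 1`, so `L ≤ 2 (4j + 2)` and `n ≤ M L`
          have h1 : (L : ℝ) ≤ 2 * (4 * j + 2 : ℕ) := by
            exact_mod_cast (show L ≤ 2 * (4 * j + 2) by omega)
          calc (n : ℝ) ≤ M * L := hnML
            _ ≤ M * (2 * (4 * j + 2 : ℕ)) := mul_le_mul_of_nonneg_left h1 hM0.le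
            _ = 2 * M * (4 * j + 2 : ℕ) := by ring
      have hw : k₂ * n ≤ (J + 1) * (4 * j + 2) := by
        have hk : (0 : ℝ) ≤ k₂ := by positivity
        have hc : 2 * k₂ * M ≤ (⌈2 * k₂ * M⌉₊ : ℕ) := Nat.le_ceil _
        have e1 : (k₂ : ℝ) * n ≤ 2 * k₂ * M * (4 * j + 2 : ℕ) := by
          have := mul_le_mul_of_nonneg_left hn2Mh hk
          linarith
        have e2 : 2 * k₂ * M * (4 * j + 2 : ℕ) ≤ (⌈2 * k₂ * M⌉₊ : ℕ) * (4 * j + 2 : ℕ) :=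
          mul_le_mul_of_nonneg_right hc hx0
        have e3 : ((⌈2 * k₂ * M⌉₊ : ℕ) : ℝ) * (4 * j + 2 : ℕ) ≤ ((J + 1 : ℕ) : ℝ) * (4 * j + 2 : ℕ) := by
          apply mul_le_mul_of_nonneg_right _ hx0
          rw [hJdef]; push_cast; linarith
        have e4 : ((k₂ * n : ℕ) : ℝ) ≤ (((J + 1) * (4 * j + 2) : ℕ) : ℝ) := by
          push_cast
          have := (e1.trans e2).trans e3
          push_cast at this
          linarith
        exact_mod_cast e4
      have hchain :=
        pow_mul_pow_le_triLRCrossingProb_of_le p (4 * j + 2) hφ.le hε.le hhard hsq hJ1 hw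
      calc min tb tc ≤ tc := min_le_right _ _
        _ = φ ^ J * ε ^ (J - 1) := htcdef
        _ ≤ triLRCrossingProb p (k₂ * n) (4 * j + 2) := hchain
        _ ≤ triLRCrossingProb p (k₂ * n) n := triLRCrossingProb_mono_height p _ hhn

/-! ### The positivity clause, every aspect ratio -/

/-- **Nolin 2008, Thm. 2 (RSW on `𝕋`, positivity), aspect ratio `k`.** For `k ≥ 1` and `δ > 0`
there is `δ' > 0` such that for every `p` and `n ≥ 1`: `P_p(LR_𝕋(n, n)) ≥ δ` implies
`P_p(LR_𝕋(k n, n)) ≥ δ'`. (`p ≥ 1/2`: the RSW theorem at `1/2` and monotonicity; `p < 1/2`: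
`rsw_engine` with `k₁ = 1`, `k₂ = k`.) [cite: Nolin2008, §3.1 Thm. "Russo–Seymour–Welsh" (arXiv: Thm. 2)] -/
theorem Nolin2008_RSW_k {k : ℕ} (hk : 1 ≤ k) {δ : ℝ} (hδ : 0 < δ) :
    ∃ δ' : ℝ, 0 < δ' ∧ ∀ (p : unitInterval) (n : ℕ), 1 ≤ n →
      δ ≤ triLRCrossingProb p n n → δ' ≤ triLRCrossingProb p (k * n) n := by
  obtain ⟨c, hc, hhalf⟩ := tri_rsw_half_holds (k : ℝ) (by exact_mod_cast hk)
  obtain ⟨t, ht, heng⟩ := rsw_engine (k₁ := 1) (k₂ := k) le_rfl hk (half_pos hδ)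
  refine ⟨min c t, lt_min hc ht, fun p n hn hδP => ?_⟩
  rcases lt_or_ge (p : ℝ) (1 / 2) with hp | hp
  · have h1 : δ / 2 < triLRCrossingProb p n (1 * n) := by rw [one_mul]; linarith
    exact (min_le_right _ _).trans (heng p hp n hn h1)
  · have hfloor : ⌊(k : ℝ) * n⌋₊ = k * n := by rw [← Nat.cast_mul, Nat.floor_natCast]
    have hkn : 1 ≤ ⌊(k : ℝ) * n⌋₊ := by rw [hfloor]; exact Nat.mul_le_mul hk hn
    have h1 := (hhalf n hkn).1
    rw [hfloor] at h1
    have hph : half ≤ p := Subtype.coe_le_coe.1 (show ((half : unitInterval) : ℝ) ≤ p from hp)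
    exact (min_le_left _ _).trans (h1.trans (TriHexExclusive.triLRCrossingProb_mono hph _ _))

/-- **Discharge of `Nolin2008_RSW`** (Nolin 2008, Thm. 2, positivity at aspect ratio `2`). [cite: Nolin2008, §3.1 Thm. "Russo–Seymour–Welsh" (arXiv: Thm. 2)] -/
theorem Nolin2008_RSW_holds : Nolin2008_RSW := by
  intro δ hδ _hδ1
  obtain ⟨δ', hδ', h⟩ := Nolin2008_RSW_k (k := 2) (by norm_num) hδ
  exact ⟨δ', hδ', h⟩

/-! ### The "moreover" clause -/

/-- **Discharge of `Nolin2008_RSW_one`** (Nolin 2008, Thm. 2, "Moreover": `f_k(δ) → 1` as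
`δ → 1`). For `p ≤ 1/2` the rhombus is crossed with probability `≤ 1/2` (duality), so with
`δ₀ > 1/2` only `p > 1/2` matters; there, by duality, the claim is `rsw_engine` (`k₁ = k`,
`k₂ = 1`) for the closed sites, of density `1 - p < 1/2`. [cite: Nolin2008, §3.1 Thm. "Russo–Seymour–Welsh" (arXiv: Thm. 2), "Moreover"] [cite: BollobasRiordan2006, Ch. 5 Lemma 7] -/
theorem Nolin2008_RSW_one_holds : Nolin2008_RSW_one := by
  intro k hk η hη
  obtain ⟨t, ht, heng⟩ := rsw_engine (k₁ := k) (k₂ := 1) (le_trans (by norm_num) hk) le_rfl hη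
  obtain ⟨t', ht'0, ht'h, ht't⟩ : ∃ t' : ℝ, 0 < t' ∧ t' ≤ 1 / 2 ∧ t' ≤ t :=
    ⟨min t (1 / 2), lt_min ht (by norm_num), min_le_right _ _, min_le_left _ _⟩
  refine ⟨1 - t' / 2, by linarith, by linarith, fun p n hn hδ₀ => ?_⟩
  have hdual1 := triLRCrossingProb_add_eq_one p n n
  rcases le_or_gt (p : ℝ) (1 / 2) with hp | hp
  · -- `p ≤ 1/2`: `P_p(LR(n, n)) ≤ 1/2 < δ₀`
    exfalso
    have hpσ : p ≤ σ p := Subtype.coe_le_coe.1 (by rw [unitInterval.coe_symm_eq]; linarith)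
    have hmono := TriHexExclusive.triLRCrossingProb_mono hpσ n n
    linarith
  · -- `p > 1/2`: duality with the closed sites at density `1 - p`
    have hp' : ((σ p : unitInterval) : ℝ) < 1 / 2 := by rw [unitInterval.coe_symm_eq]; linarith
    have hdual2 := triLRCrossingProb_add_eq_one p (k * n) n
    have hsmall : triLRCrossingProb (σ p) n n < t := by linarith
    by_contra hcon
    push Not at hcon
    have hη' : η < triLRCrossingProb (σ p) n (k * n) := by linarith
    have h := heng (σ p) hp' n hn hη'
    rw [one_mul] at h
    linarith

/-! ### The printed theorem -/

/-- **Discharge of `Nolin2008_RSW_thm`** (Nolin 2008, §3.1, Thm. "Russo–Seymour–Welsh", as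
printed): the universal functions are `f_k(δ) = inf {P_p(LR_𝕋(kn, n)) : n ≥ 1, P_p(LR_𝕋(n, n)) ≥
min(δ, 1)}` — non-decreasing by construction, positive on `(0, 1)` by `Nolin2008_RSW_k`, tending
to `1` at `1` by `Nolin2008_RSW_one_holds`, and below every admissible crossing probability. [cite: Nolin2008, §3.1 Thm. "Russo–Seymour–Welsh" (arXiv: Thm. 2)] -/
theorem Nolin2008_RSW_thm_holds : Nolin2008_RSW_thm := by
  classical
  -- the admissible sets and the functions `f k δ = sInf (S k δ)`
  obtain ⟨S, hS⟩ : ∃ S : ℕ → ℝ → Set ℝ, S = fun k δ => {x : ℝ | ∃ (p : unitInterval) (n : ℕ),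
      1 ≤ n ∧ min δ 1 ≤ triLRCrossingProb p n n ∧ x = triLRCrossingProb p (k * n) n} := ⟨_, rfl⟩
  have hmem : ∀ {k : ℕ} {δ x : ℝ}, x ∈ S k δ ↔ ∃ (p : unitInterval) (n : ℕ),
      1 ≤ n ∧ min δ 1 ≤ triLRCrossingProb p n n ∧ x = triLRCrossingProb p (k * n) n := by
    intro k δ x; rw [hS]; rfl
  have hbdd : ∀ k δ, BddBelow (S k δ) := fun k δ => ⟨0, by
    intro x hx
    obtain ⟨p, n, -, -, rfl⟩ := hmem.1 hx
    unfold triLRCrossingProb; exact measureReal_nonneg⟩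
  have hone : ∀ n : ℕ, 1 ≤ triLRCrossingProb 1 n n := fun n => by
    have h := pow_succ_le_triLRCrossingProb 1 n n
    rwa [show (((1 : unitInterval)) : ℝ) = 1 from Set.Icc.coe_one, one_pow] at h
  have hone_mem : ∀ k δ, triLRCrossingProb 1 (k * 1) 1 ∈ S k δ := fun k δ =>
    hmem.2 ⟨1, 1, le_rfl, (min_le_right _ _).trans (hone 1), rfl⟩
  have hne : ∀ k δ, (S k δ).Nonempty := fun k δ => ⟨_, hone_mem k δ⟩
  refine ⟨fun k δ => sInf (S k δ), ?_, ?_, ?_, ?_⟩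
  · -- non-decreasing
    intro k _hk δ δ' hδδ'
    apply csInf_le_csInf (hbdd k δ) (hne k δ')
    intro x hx
    obtain ⟨p, n, hn, hP, rfl⟩ := hmem.1 hx
    exact hmem.2 ⟨p, n, hn, (min_le_min hδδ' le_rfl).trans hP, rfl⟩
  · -- positive on `(0, 1)`
    intro k hk δ hδ hδ1
    obtain ⟨δ₁, hδ₁, h⟩ := Nolin2008_RSW_k (le_trans (by norm_num) hk) hδ
    refine lt_of_lt_of_le hδ₁ (le_csInf (hne k δ) ?_)
    intro x hx
    obtain ⟨p, n, hn, hP, rfl⟩ := hmem.1 hx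
    rw [min_eq_left hδ1.le] at hP
    exact h p n hn hP
  · -- `f_k(δ) → 1` as `δ ↑ 1`
    intro k hk
    rw [tendsto_order]
    refine ⟨fun a ha => ?_, fun a ha => Filter.Eventually.of_forall fun δ => ?_⟩
    · obtain ⟨δ₀, _hδ₀0, hδ₀1, h⟩ := Nolin2008_RSW_one_holds k hk ((1 - a) / 2) (by linarith)
      filter_upwards [Ioo_mem_nhdsLT hδ₀1] with δ hδ
      have hle : 1 - (1 - a) / 2 ≤ sInf (S k δ) := by
        apply le_csInf (hne k δ)
        intro x hx
        obtain ⟨p, n, hn, hP, rfl⟩ := hmem.1 hx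
        rw [min_eq_left hδ.2.le] at hP
        exact h p n hn (hδ.1.le.trans hP)
      show a < sInf (S k δ)
      linarith
    · show sInf (S k δ) < a
      calc sInf (S k δ) ≤ triLRCrossingProb 1 (k * 1) 1 := csInf_le (hbdd k δ) (hone_mem k δ)
        _ ≤ 1 := TriHexagon.triLRCrossingProb_le_one' _ _ _
        _ < a := ha
  · -- the bound
    intro k _hk p n hn δ₁ hδ₁
    exact csInf_le (hbdd k δ₁) (hmem.2 ⟨p, n, hn, (min_le_left _ _).trans hδ₁, rfl⟩)

end Literature.Probability.Percolation
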